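import Mathlib
import Literature.Barriers.ValiantsHypothesis.MonotoneGapDecomposition
import Literature.Barriers.ValiantsHypothesis.MonotoneGapParseTrees
import Literature.Computability.AlgebraicComplexity.ArithCircuitProofs
import Summits.ValiantsHypothesis.ValiantsHypothesis.Theorems.DivisionGapPerMultiplesHardStubTypedDecomposition
import Summits.ValiantsHypothesis.ValiantsHypothesis.Theorems.DivisionGapPerMultiplesHardStubTypedDecompositionFifth

/-!
# `DivisionGap.PerMultiplesHard` (stmt-ValiantsHypothesis-5068), line `uncharged-face-walk`:
the typed decomposition with the gate-factor complexity bound (stub `stub_typedDecompositionL`)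

For `3 ≤ D ≤ n`, a torus-homogeneous `g ∈ ℝ≥0[x_ij]` (`n × n` variables; all monomials have row
margins `R` and column margins `C`) with all `R i ≠ 0` writes as `g = Σ_{t<s} a_t · b_t` with
`s ≤ L(g)` (`L = complexity`), every `a_t` torus-homogeneous with margins `(ρ, γ)` whose row
support `k = #{i | ρ i ≠ 0}` satisfies `n < Dk ≤ 2n`, AND `L(a_t) ≤ L(g)` for every `t`.

Proof: verbatim the landed window version `typedDecompositionWindow`
(`Theorems/DivisionGapPerMultiplesHardStubTypedDecompositionFifth.lean`, p105314) with one
invariant threaded through the peeling induction: every circuit of the peeling sequence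
`P₀, P₀.zeroAt v₁, (P₀.zeroAt v₁).zeroAt v₂, …` has `size = P₀.size = L(g)` (`zeroAt` is a
`List.set`, `size_zeroAt`), and every `a_t` is a GATE VALUE `(gateValues P.gates).getD v 0` of such
a circuit `P`, computed by the fan-in-two circuit `⟨P.gates, .gate v⟩` of the same size, so
`L(a_t) ≤ P.size = L(g)` (the defining inequality `complexity_le_size`; cf.
`AdditiveCreation.complexity_getD_gateValues_le` in
`Theorems/DivisionGapPerCofactorDegreeReductionStubAdditiveCreation.lean`).

-- adapted from DivisionGapPerMultiplesHardStubTypedDecompositionFifth.lean (p105314)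
-/

noncomputable section

-- the namespace is mandated by the crux (`Summit.ValiantsHypothesis.ValiantsHypothesis.…`)
set_option linter.dupNamespace false

open MvPolynomial Literature.Computability.AlgebraicComplexity
open scoped NNReal BigOperators
open Literature.Barriers.ValiantsHypothesis
open Literature.Computability.AlgebraicComplexity.ArithCircuit
open Summit.ValiantsHypothesis.ValiantsHypothesis.Theorems.DivisionGap.PerMultiplesHard.TypedDecomposition
open Summit.ValiantsHypothesis.ValiantsHypothesis.Theorems.DivisionGap.PerMultiplesHard.TypedDecompositionFifth

namespace Summit.ValiantsHypothesis.ValiantsHypothesis.Theorems.DivisionGap.PerMultiplesHard.TypedDecompositionL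

section Size

variable {k : Type*} {σ : Type*}

/-- Zeroing a gate does not change the number of gates (`zeroAt` is a `List.set`). [folklore] -/
theorem size_zeroAt (P : ArithCircuit k σ) (v : ℕ) : (P.zeroAt v).size = P.size :=
  List.length_set ..

end Size

/-- **The peeling induction, window `(n/D, 2n/D]`, with the gate-factor cost bound.** A fan-in-two
circuit over `ℝ≥0` of size `≤ S` whose gate values vanish outside a set `Z` of at most `N` indices
and whose output is typed with margins `(R, C)`, all `R i > 0`, writes its output as a sum of at
most `N` products `a · b`, every `a` of complexity `≤ S` and typed with row support `k`,
`n < Dk ≤ 2n` (`3 ≤ D ≤ n`): zero a window gate `v` (`exists_eval_eq_zeroAt_add`), whose value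
`a = p_v` is computed by `⟨P.gates, .gate v⟩` of size `≤ S`, type `p_v` through
`supp (p_v · q) ⊆ supp P.eval` when `q ≠ 0`, and recurse on `P.zeroAt v` (same size).
[cite: JerrumSnir1982, §3 (Lemma 3.1(iii), Thm. 3.2)] -/
theorem exists_typed_list_L (n D : ℕ) (hD : 3 ≤ D) (hDn : D ≤ n) (R C : Fin n → ℕ)
    (hR : ∀ i, R i ≠ 0) (S : ℕ) :
    ∀ (N : ℕ) (P : ArithCircuit ℝ≥0 (Fin n × Fin n)), P.IsFanInTwo → P.size ≤ S →
      (∃ Z : Finset ℕ, Z.card ≤ N ∧ ∀ j ∉ Z, (gateValues P.gates).getD j 0 = 0) →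
      (∀ m ∈ P.eval.support, (∀ i, ∑ j, m (i, j) = R i) ∧ (∀ j, ∑ i, m (i, j) = C j)) →
      ∃ L : List (MvPolynomial (Fin n × Fin n) ℝ≥0 × MvPolynomial (Fin n × Fin n) ℝ≥0),
        L.length ≤ N ∧ P.eval = (L.map fun ab => ab.1 * ab.2).sum ∧
        ∀ ab ∈ L, complexity ab.1 ≤ S ∧ ∃ ρ γ : Fin n → ℕ,
          (∀ m ∈ ab.1.support, (∀ i, ∑ j, m (i, j) = ρ i) ∧ (∀ j, ∑ i, m (i, j) = γ j)) ∧
          n < D * (Finset.univ.filter fun i => ρ i ≠ 0).card ∧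
          D * (Finset.univ.filter fun i => ρ i ≠ 0).card ≤ 2 * n := by
  intro N
  induction N with
  | zero =>
    rintro P h2 - ⟨Z, hZc, hZ0⟩ hg
    by_cases h0 : P.eval = 0
    · exact ⟨[], le_rfl, by simp [h0], by simp⟩
    · exfalso
      obtain ⟨v, hlo, -⟩ :=
        exists_window_gate_window n D hD hDn R hR P h2 (fun m hm => (hg m hm).1) h0
      have hv : (gateValues P.gates).getD v 0 = 0 :=
        hZ0 v (by simp [Finset.card_eq_zero.mp (Nat.le_zero.mp hZc)])
      rw [hv, vars_0, Finset.image_empty, Finset.card_empty] at hlo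
      omega
  | succ N ih =>
    rintro P h2 hS ⟨Z, hZc, hZ0⟩ hg
    by_cases h0 : P.eval = 0
    · exact ⟨[], by simp, by simp [h0], by simp⟩
    obtain ⟨v, hlo, hhi⟩ :=
      exists_window_gate_window n D hD hDn R hR P h2 (fun m hm => (hg m hm).1) h0
    obtain ⟨q, hq⟩ := exists_eval_eq_zeroAt_add P v
    have hlink := linked_gateValues_set P.gates v
    -- the value of gate `v` is computed by `⟨P.gates, .gate v⟩`, fan-in-two of size `P.size ≤ S`
    have hcost : complexity ((gateValues P.gates).getD v 0) ≤ S :=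
      (complexity_le_size (P := ⟨P.gates, .gate v⟩) h2 rfl).trans hS
    set p := (gateValues P.gates).getD v 0
    have hp0 : p ≠ 0 := by
      intro h
      rw [h, vars_0, Finset.image_empty, Finset.card_empty] at hlo
      omega
    have hvZ : v ∈ Z := by_contra fun h => hp0 (hZ0 v h)
    -- the zeroed circuit: same size, values vanish outside `Z.erase v`, output still typed
    have hS' : (P.zeroAt v).size ≤ S := (size_zeroAt P v).trans_le hS
    have hZ' : ∃ Z' : Finset ℕ, Z'.card ≤ N ∧
        ∀ j ∉ Z', (gateValues (P.zeroAt v).gates).getD j 0 = 0 := by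
      refine ⟨Z.erase v, ?_, fun j hj => ?_⟩
      · rw [Finset.card_erase_of_mem hvZ]; omega
      · by_cases hjv : j = v
        · subst hjv; exact getD_gateValues_set_zeroGate P.gates j
        · have hjZ : j ∉ Z := fun h => hj (Finset.mem_erase.mpr ⟨hjv, h⟩)
          obtain ⟨h, hh⟩ := hlink.2 j
          rw [hZ0 j hjZ] at hh
          exact eq_zero_of_zero_eq_add hh
    have hg' : ∀ m ∈ (P.zeroAt v).eval.support,
        (∀ i, ∑ j, m (i, j) = R i) ∧ (∀ j, ∑ i, m (i, j) = C j) :=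
      fun m hm => hg m (support_subset_of_eq_add hq hm)
    obtain ⟨L, hLlen, hLsum, hLtyp⟩ := ih (P.zeroAt v) (h2.zeroAt v) hS' hZ' hg'
    by_cases hq0 : q = 0
    · refine ⟨L, by omega, ?_, hLtyp⟩
      rw [hq, hq0, mul_zero, add_zero, hLsum]
    · have hsub : (p * q).support ⊆ P.eval.support :=
        support_subset_of_eq_add (hq.trans (add_comm _ _))
      obtain ⟨ρ, γ, hty⟩ := exists_margins_of_support_mul_subset hg hsub hq0
      refine ⟨(p, q) :: L, by simpa using hLlen, ?_, ?_⟩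
      · simp only [List.map_cons, List.sum_cons]
        rw [hq, hLsum, add_comm]
      · intro ab hab
        rcases List.mem_cons.mp hab with rfl | hab
        · refine ⟨hcost, ρ, γ, hty, ?_⟩
          rw [filter_ne_zero_eq_image_fst_vars (fun m hm => (hty m hm).1) hp0]
          exact ⟨hlo, hhi⟩
        · exact hLtyp ab hab

/-- **The typed decomposition with the window `(n/D, 2n/D]`, `3 ≤ D ≤ n`, and the gate-factor
cost bound.** A torus-homogeneous `g` over `ℝ≥0` (all monomials have margins `(R, C)`) with all
`R i ≠ 0` writes as `g = Σ_{t < s} a_t · b_t` with `s ≤ L(g)`, every `a_t` of complexity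
`L(a_t) ≤ L(g)` and torus-homogeneous with margins `(ρ, γ)`, `n < D · #{i | ρ i ≠ 0} ≤ 2n`: peel
(`exists_typed_list_L`) a minimal fan-in-two circuit for `g` (`exists_computes_size_eq_complexity`)
at most `size = L(g)` times; every circuit of the peeling sequence has `L(g)` gates.
[cite: JerrumSnir1982, §3 (Lemma 3.1(iii), Thm. 3.2, proof of Thm. 3.4)] -/
theorem typedDecompositionL (n D : ℕ) (hD : 3 ≤ D) (hDn : D ≤ n)
    (g : MvPolynomial (Fin n × Fin n) ℝ≥0) (R C : Fin n → ℕ)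
    (hg : ∀ m ∈ g.support, (∀ i, ∑ j, m (i, j) = R i) ∧ (∀ j, ∑ i, m (i, j) = C j))
    (hR : ∀ i, R i ≠ 0) :
    ∃ s : ℕ, s ≤ complexity g ∧
      ∃ a b : Fin s → MvPolynomial (Fin n × Fin n) ℝ≥0,
        g = ∑ t, a t * b t ∧
        ∀ t, complexity (a t) ≤ complexity g ∧ ∃ ρ γ : Fin n → ℕ,
          (∀ m ∈ (a t).support, (∀ i, ∑ j, m (i, j) = ρ i) ∧ (∀ j, ∑ i, m (i, j) = γ j)) ∧
          n < D * (Finset.univ.filter fun i => ρ i ≠ 0).card ∧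
          D * (Finset.univ.filter fun i => ρ i ≠ 0).card ≤ 2 * n := by
  obtain ⟨P, h2, hPg, hsize⟩ := exists_computes_size_eq_complexity g
  have heval : P.eval = g := hPg
  subst heval
  have hZ : ∃ Z : Finset ℕ, Z.card ≤ P.size ∧ ∀ j ∉ Z, (gateValues P.gates).getD j 0 = 0 := by
    refine ⟨Finset.range P.size, by simp, fun j hj => getD_gateValues_eq_zero ?_⟩
    exact List.getElem?_eq_none_iff.mpr (by simpa [ArithCircuit.size] using hj)
  obtain ⟨L, hLlen, hLsum, hLtyp⟩ :=
    exists_typed_list_L n D hD hDn R C hR (complexity P.eval) P.size P h2 hsize.le hZ hg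
  refine ⟨L.length, hsize ▸ hLlen, fun t => (L[t.1]).1, fun t => (L[t.1]).2, ?_,
    fun t => hLtyp _ (List.getElem_mem _)⟩
  rw [Fin.sum_univ_fun_getElem L (fun ab => ab.1 * ab.2)]
  exact hLsum

/-- **The typed decomposition with the gate-factor complexity bound** (stub
`stub_typedDecompositionL`). For `3 ≤ D ≤ n`, a torus-homogeneous `g` over `ℝ≥0` (all monomials
have margins `(R, C)`) with all `R i ≠ 0` writes as `g = Σ_{t < s} a_t · b_t` with `s ≤ L(g)`,
every `a_t` of complexity `≤ L(g)` and torus-homogeneous with margins `(ρ, γ)`,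
`n < D · #{i | ρ i ≠ 0} ≤ 2n`: the curried form of `typedDecompositionL`.
[cite: JerrumSnir1982, §3 (Lemma 3.1(iii), Thm. 3.2, proof of Thm. 3.4)] -/
theorem stub_typedDecompositionL :
    ∀ (n D : ℕ), 3 ≤ D → D ≤ n → ∀ (g : MvPolynomial (Fin n × Fin n) ℝ≥0) (R C : Fin n → ℕ),
      (∀ m ∈ g.support, (∀ i, ∑ j, m (i, j) = R i) ∧ (∀ j, ∑ i, m (i, j) = C j)) →
      (∀ i, R i ≠ 0) →
      ∃ s : ℕ, s ≤ complexity g ∧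
        ∃ a b : Fin s → MvPolynomial (Fin n × Fin n) ℝ≥0, g = ∑ t, a t * b t ∧
          ∀ t, complexity (a t) ≤ complexity g ∧ ∃ ρ γ : Fin n → ℕ,
            (∀ m ∈ (a t).support, (∀ i, ∑ j, m (i, j) = ρ i) ∧ (∀ j, ∑ i, m (i, j) = γ j)) ∧
            n < D * (Finset.univ.filter fun i => ρ i ≠ 0).card ∧
            D * (Finset.univ.filter fun i => ρ i ≠ 0).card ≤ 2 * n :=
  fun n D hD hDn g R C hg hR => typedDecompositionL n D hD hDn g R C hg hR

end Summit.ValiantsHypothesis.ValiantsHypothesis.Theorems.DivisionGap.PerMultiplesHard.TypedDecompositionL
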